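import Summits.QuantumFields.YangMills.Theorems.BalabanUVNodesN11NoExpansionDiagonalClauseStep
import Summits.QuantumFields.YangMills.Theorems.BalabanUVNodesN11NoExpansionTermFree
import Summits.QuantumFields.YangMills.Theorems.BalabanUVNodesN11TkBranchWeightCongr
import Literature.MathematicalPhysics.QuantumFieldTheory.Balaban1983to89.Node00.Record13CoPH

/-!
# DAG node N11 — THE NO-EXPANSION DIAGONAL OF K1's 𝐓-LAW AT THE v1.7 `CoPH` RECORD (history-indexed residual `Zh`, FINDING №9 ∕ director-ym №183 H1ʰ, (α)):
# PART 1 — (1) the §2 RESIDUAL DATUM IS NOT READ by the (2.23) action ∕ operand ∕ slot of record (every sequence: φ cancels by (2.24) telescoping, `bgI∕bgMS`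
# enter the laws only) — so the history's `θ.rzAt p s` may replace the torus's `θ.Rz p.K` in every §2 IDENTITY clause of this seat's theorems; (2) level one of `TLaw₁₃CoPH` under the generation-0 pin on `θ.zhAt p s′`, for a GENERIC `θ : Stage13HParams`
# (PART 2 `…CoPHSucc`: the clause-keyed level-(k+1) step under the DISPLAYED prefix agreement — director-ym №186 (2) — and the door images)

Cell `pub-ymgap`, YM-PLAN Track A (HUMAN RULING D-0062), seat `pub-ymgap-dag-n11-d` (g8; R134 fan-out seat N11 [B14], strategy s2), route `BalabanUVNodes`
rev 23, item K1⁶ `StabilityBAtRecordR13SepCoPR` = stmt-QuantumFields-20507 (helper, count-neutral; ⁷ twin after KEY-24).  [III] = [Balaban1988Convergent].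
Over node00-def-T's FILE 27 `Node00/Record13CoPH` (p537939: `Stage13HParams` with `Zh p n Ω Λ`, `Phih`; `zhAt`, `rzAt`, `WtOfRecord₁₃H θ p s :=
tkWeightsOfRecordP … (θ.zhAt p s)`; `TLaw₁₃CoPH θ p k ↔ HasSect2FormTAEZS … (θ.rzAt p) (WtOfRecord₁₃H θ p) (UbgOfRecord₁₃CoP θ.toStage13Params p (k+1)) slotsT`;
door `Stage13HParams.ofHistoryBlind`), this seat's `…NoExpansionDiagonalAtZ` (p532335, free residual `Z`), `…NoExpansionDiagonalClauseStep` (p535033, clause-keyed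
step at a free `Z`), `…NoExpansionTermFree` (p495297, `action23_of_forall_Omega_empty` — generic in the residual), `…TkBranchWeightCongr` (p536516, (PC) prefix
congruence) and `…NoExpansionDiagonalCoPR` (p532711, the v1.6 images).

WHY THIS FILE.  This seat's g3–g7 chain of no-expansion 𝐓-conjunct theorems hardcodes the §2 residual of the torus, `θ.Rz p.K`; the v1.7 clause of
`TLaw₁₃CoPH` reads the HISTORY's residual `θ.rzAt p s = ⟨bgI, bgMS, θ.Phih p n s.Ω s.Λ⟩` (director-ym №187 (1), C2 fold) and the HISTORY's weights
`WtOfRecord₁₃H θ p s` built on `θ.zhAt p s = θ.Zh p n s.Ω s.Λ` (LEVEL-indexed, (α)).  Two facts make the port exact rather than approximate: (i) the (2.23) action OF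
RECORD does not read the residual datum at all — the smearing functions `φ_j` cancel between the local coupling (2.24) and the 𝐄-counterterms of (2.25)
(`wilsonLocal_add_E225`, used by g4∕g7 along the diagonal; here for EVERY sequence) and `bgI ∕ bgMS` enter the law packages only — so `sect2Operand` and
`sect2Slot` do not read the residual (§1; LOCATED for def-T∕ref-H: the C2 fold of `Phih` is visible to the laws `LawsRT∕LawsT` only, not to any identity clause); (ii) the weights enter a length-`k`
slot through the generations `j < k` only ((PC)), so the level-`k` identity at `init s′` at the weights of `init s′` IS the identity at the weights of `s′` once
`θ.zhAt p s′` and `θ.zhAt p (init s′)` agree on `ζ0_j`, `quad_j` for `j < k` — the displayed prefix agreement `hpre` of §4 (at the door `ofHistoryBlind θ` it is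
`rfl`; at a history-reading witness it is the lemma about print's witness of director-ym №186 (2), NOT supplied by the record).

WHAT THIS FILE PROVES (0 `sorry`, 0 `def`, standard axioms; `N`-generic; every `θ : Stage13HParams`, every run).
§1 ★★ `action23_congr_residual` ∕ `sect2Operand_congr_residual` ∕ `sect2Slot_congr_residual` — FOR EVERY SEQUENCE the (2.23) action, the §2 operand and the
§2-form slot of record DO NOT READ the residual datum (φ cancels by `wilsonLocal_add_E225`; `bgI ∕ bgMS` enter the laws only) — then `sect2Operand_eq_of_forall_Omega_empty`
(closed form `e^{−g₀⁻²A(U(W)) − E}` along all-`Ω`-empty sequences) and the all-`Ω`-empty instances `…_congr_residual_of_forall_Omega_empty` (generic `K`, setting,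
two residuals, weights, term values).  §2 `WtOfRecord₁₃H_eq_tkWeightsOfRecordP` (`rfl`),
`zhAt_eq` (`rfl`).  §3 ★ `slotsT_one_ae_eq_sect2Slot_CoPH_of_zeta0_pin` ∕ `hasSect2FormAtZS_clause_one_CoPH_of_zeta0_pin` ∕ `…_of_provisos` (level one of
`TLaw₁₃CoPH` at the all-large-field `s′`, `E_1(s′) = E(p)`, under the pin `(θ.zhAt p s′).ζ0 0 T (U, V₁) = w(s′)(U, Ū)`, `quad_0(∅) = 0`).  The clause-keyed
level-(k+1) step under the displayed prefix agreement (§4) and the door images (§5) are the sequel `…NoExpansionDiagonalCoPHSucc`.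

HONEST FRAMING ∕ A6 (director-ym №189 (3)).  Kernel bookkeeping on def-T's v1.7 typing (count-neutral).  §1–§2 are hypothesis-free.  §3's binders: the pins
`hZ`∕`hq` on `(θ.zhAt p s′).ζ0 0 T`, `.quad 0 ∅` are INHABITED at the history-blind door of node00-def-K0a's cured residual — `θ := Stage13HParams.ofHistoryBlind
(Stage13RParams.ofCured θ₀)`, where `zhAt = ZrOfRecord₁₃ θ₀ p` (`rfl`) and p532711 §2∕§3 (`…CoPR_of_Zr_eq_ZrOfRecord`, `…ofCured_of_provisosCore`) discharge them
from K0a's FILE 17 faces; `hζu`∕`hmw` are rows of `Provisos₁₃CoPH` (`…_of_provisos`); `hK`, `hM`, `hΩ` are data.  At a history-READING `θ.Zh` the pins are a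
statement about the VALUE of `Zh` (H3, node00-def-K0a∕K0b's lane after the [IV]-body read) — not exhibited here.  Nothing of Bałaban's is asserted ([III] controls
the all-large-field terms by §3's bounds; whether print's R^{(k+1)} leaves the all-large component untouched is [IV]-body content, unread).  N11 NOT discharged; K1⁶ NOT
closed; counts unmoved (typed 28∕28 · discharged 5∕28).  One finite four-torus programme at fixed `ε = L^{−K}`; NOT ℝ⁴, NOT OS, NOT a mass gap, NOT Clay.
Sources: [III] Theorem p.245, (2.18) p.257, (2.20)–(2.25) pp.258–259, (3.16) p.268, (3.24)–(3.25) p.270, p.267, (1.11) p.248; [IV] (0.2)–(0.3) p.176.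
-/

noncomputable section

open MeasureTheory
open scoped BigOperators Matrix.Norms.L2Operator

namespace Summit.QuantumFields.YangMills.Theorems.BalabanUVNodesN11NoExpansionDiagonalCoPH

open Literature.MathematicalPhysics.QuantumFieldTheory.Balaban1983to89 T4Continuum Node00 Node00.Tk DagBinding
open B15DeterminingSets
open BalabanUVNodesN11NoExpansionTermFree (action23_of_forall_Omega_empty)
open BalabanUVNodesN11NoExpansionAllLargeCoP (init_allLarge)
open BalabanUVNodesN11NoExpansionDiagonalAtZ (slotsT_one_ae_eq_sect2Slot_atZ_of_zeta0_pin)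

variable {F : T4Family} {N : ℕ} [NeZero N]

/-! ## §1. The §2 residual datum is not read by the (2.23) action ∕ operand ∕ slot of record -/

section Residual

variable {𝔸 : Type*} [NormedRing 𝔸] [NormedAlgebra ℂ 𝔸] [CompleteSpace 𝔸]
variable {ν : Stage7Numerics} {M : ℕ} {g : ℕ → ℝ} {K n : ℕ}

/-- **THE (2.23) ACTION OF RECORD DOES NOT READ THE §2 RESIDUAL DATUM — FOR EVERY SEQUENCE.**  In r11's typed (2.23)–(2.25) the smearing functions `φ_j`
enter only through the local coupling `1∕g_n²(·)` (2.24) and the `β_j(g_{j−1})·A(φ_j, ·)` counterterms of (2.25), which cancel identically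
(`B14.Eq225Concrete.wilsonLocal_add_E225`); the spaces-data `bgI`, `bgMS` enter only the LAW packages (`Sect2.LawsRT ∕ LawsT` through the tower's `space ∕ spaceB`),
never the value `A_n(s)(U)`.  Hence two residual data give the SAME action, definitionally after the telescoping — in particular the history's `θ.rzAt p s` of the
v1.7 record (director-ym №187 (1), C2 fold of `Phih`) and the torus's `θ.Rz p.K` are interchangeable in every §2 IDENTITY clause (located remark: the C2 fold is
visible to the laws only). [cite: Balaban1988Convergent, (2.23)–(2.25) pp.258–259; Balaban1989LargeFieldI, (0.2)–(0.3) p.176] -/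
theorem action23_congr_residual (S : Sect2.Setting 𝔸 (SU N)) (Rz Rz' : Sect2.Residual (F.P K) 𝔸)
    (s : SeqOfRecord F ν M g K n) (t : Sect2.TermValues (F.P K) 𝔸 (FluctV N) M) (a : Tk.SFluct (F.P K) (FluctV N)) (Ek : ℝ)
    (U : GaugeField (F.P K) 0 (SU N)) :
    (sect2ActionDataOfRecord F N (FluctV N) K S Rz s t a Ek).action23 n U = (sect2ActionDataOfRecord F N (FluctV N) K S Rz' s t a Ek).action23 n U := by
  show (Sect2.actionDataOfTerms S Rz ν M g s.Ω s.Λ t n a Ek).action23 n U = (Sect2.actionDataOfTerms S Rz' ν M g s.Ω s.Λ t n a Ek).action23 n U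
  rw [Sect2.action23_actionDataOfTerms, Sect2.action23_actionDataOfTerms]
  have hW : ∀ R : Sect2.Residual (F.P K) 𝔸, -B14.Eq225Concrete.smearedWilson (B14.LocalCoupling.invSq S.flow R.phi n) U +
      B14.Eq225Concrete.E225 (Sect2.towerOfTerms S R M s.Ω t) (fun j X z => Sect2.admE (F.P K) ν M g s.Λ j (Sect2.domSites (F.P K) M j X) z) R.phi n U =
      -(1 / (S.flow.g 0) ^ 2 * wilsonAction4 U) +
        ∑ j ∈ Finset.Icc 1 n, B14.Eq225Concrete.EjSub (Sect2.towerOfTerms S R M s.Ω t)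
          (fun j X z => Sect2.admE (F.P K) ν M g s.Λ j (Sect2.domSites (F.P K) M j X) z) j U :=
    fun R => B14.Eq225Concrete.wilsonLocal_add_E225 (Sect2.towerOfTerms S R M s.Ω t) _ R.phi n U
  rw [hW Rz, hW Rz']
  rfl

/-- **★ THE §2 OPERAND `e^{A_n(s)}` DOES NOT READ THE RESIDUAL DATUM** (every sequence, setting, witness, constant, background map).
[cite: Balaban1988Convergent, (2.18) p.257, (2.23)–(2.25) pp.258–259] -/
theorem sect2Operand_congr_residual (S : Sect2.Setting 𝔸 (SU N)) (Rz Rz' : Sect2.Residual (F.P K) 𝔸)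
    (s : SeqOfRecord F ν M g K n) (t : Sect2.TermValues (F.P K) 𝔸 (FluctV N) M) (Ek : ℝ) (U : BgMap F N K) :
    sect2Operand F N (FluctV N) K S Rz s t Ek U = sect2Operand F N (FluctV N) K S Rz' s t Ek U := by
  funext a W
  show Real.exp ((sect2ActionDataOfRecord F N (FluctV N) K S Rz s t a Ek).action23 n (U W)) =
    Real.exp ((sect2ActionDataOfRecord F N (FluctV N) K S Rz' s t a Ek).action23 n (U W))
  rw [action23_congr_residual S Rz Rz' s t a Ek (U W)]

/-- **★ THE §2-FORM SLOT `𝐓_n(s)[W] e^{A_n(s)}` DOES NOT READ THE RESIDUAL DATUM** (every sequence and weight family).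
[cite: Balaban1988Convergent, (2.18) p.257, (2.23)–(2.25) pp.258–259] -/
theorem sect2Slot_congr_residual (S : Sect2.Setting 𝔸 (SU N)) (Rz Rz' : Sect2.Residual (F.P K) 𝔸) (W : TkWeights F N (FluctV N) K)
    (s : SeqOfRecord F ν M g K n) (t : Sect2.TermValues (F.P K) 𝔸 (FluctV N) M) (Ek : ℝ) (U : BgMap F N K) :
    sect2Slot F N (FluctV N) K S Rz W s t Ek U = sect2Slot F N (FluctV N) K S Rz' W s t Ek U := by
  unfold sect2Slot
  rw [sect2Operand_congr_residual S Rz Rz' s t Ek U]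

/-- **THE §2 OPERAND IN CLOSED FORM ALONG AN ALL-`Ω`-EMPTY SEQUENCE**: `e^{A_n(s)(U(W))} = e^{−g₀⁻²A(U(W)) − E_n}` for EVERY residual, term-value witness and
fluctuation argument (`action23_of_forall_Omega_empty`: empty ranges + (2.24) telescoping; `M ≥ 1`). [cite: Balaban1988Convergent, (2.23)–(2.25) pp.258–259, (2.18) p.257] -/
theorem sect2Operand_eq_of_forall_Omega_empty (S : Sect2.Setting 𝔸 (SU N)) (Rz : Sect2.Residual (F.P K) 𝔸) (hM : 1 ≤ M)
    (s : SeqOfRecord F ν M g K n) (hΩ : ∀ j, 1 ≤ j → j ≤ n → s.Ω j = ∅) (t : Sect2.TermValues (F.P K) 𝔸 (FluctV N) M) (Ek : ℝ) (U : BgMap F N K)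
    (a : Tk.SFluct (F.P K) (FluctV N)) (W : MSField (F.P K) (SU N)) :
    sect2Operand F N (FluctV N) K S Rz s t Ek U a W = Real.exp (-(1 / (S.flow.g 0) ^ 2 * wilsonAction4 (U W)) - Ek) := by
  show Real.exp ((sect2ActionDataOfRecord F N (FluctV N) K S Rz s t a Ek).action23 n (U W)) = _
  rw [action23_of_forall_Omega_empty S Rz hM s hΩ t a Ek (U W)]

/-- The all-`Ω`-empty instance of `sect2Operand_congr_residual` (kept for the sequel's citations; the hypotheses `1 ≤ M`, all `Ω_j = ∅` are not needed).
[cite: Balaban1988Convergent, (2.23)–(2.25) pp.258–259 (bookkeeping)] -/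
theorem sect2Operand_congr_residual_of_forall_Omega_empty (S : Sect2.Setting 𝔸 (SU N)) (Rz Rz' : Sect2.Residual (F.P K) 𝔸) (_hM : 1 ≤ M)
    (s : SeqOfRecord F ν M g K n) (_hΩ : ∀ j, 1 ≤ j → j ≤ n → s.Ω j = ∅) (t : Sect2.TermValues (F.P K) 𝔸 (FluctV N) M) (Ek : ℝ) (U : BgMap F N K) :
    sect2Operand F N (FluctV N) K S Rz s t Ek U = sect2Operand F N (FluctV N) K S Rz' s t Ek U :=
  sect2Operand_congr_residual S Rz Rz' s t Ek U

/-- The all-`Ω`-empty instance of `sect2Slot_congr_residual` (kept for the sequel's citations). [cite: Balaban1988Convergent, (2.18) p.257, (2.23)–(2.25) pp.258–259 (bookkeeping)] -/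
theorem sect2Slot_congr_residual_of_forall_Omega_empty (S : Sect2.Setting 𝔸 (SU N)) (Rz Rz' : Sect2.Residual (F.P K) 𝔸) (W : TkWeights F N (FluctV N) K)
    (_hM : 1 ≤ M) (s : SeqOfRecord F ν M g K n) (_hΩ : ∀ j, 1 ≤ j → j ≤ n → s.Ω j = ∅) (t : Sect2.TermValues (F.P K) 𝔸 (FluctV N) M) (Ek : ℝ)
    (U : BgMap F N K) : sect2Slot F N (FluctV N) K S Rz W s t Ek U = sect2Slot F N (FluctV N) K S Rz' W s t Ek U :=
  sect2Slot_congr_residual S Rz Rz' W s t Ek U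

end Residual

/-! ## §2. Faces of the v1.7 record's history-indexed weights -/

section Faces

variable (θ : Stage13HParams F N) (p : B12.RunParams)

/-- The run's weights for the history `s` ARE 12a″'s weights over the residual serving `s` (`rfl`). [cite: Balaban1988Convergent, (2.21) p.258, p.257 (bookkeeping)] -/
theorem WtOfRecord₁₃H_eq_tkWeightsOfRecordP {n : ℕ} (s : SeqOfRecord F θ.ν θ.τ9.M (gOfRecord₁₃ F N θ.toStage13Params p) p.K n) :
    WtOfRecord₁₃H F N θ p s = tkWeightsOfRecordP F N (FluctV N) θ.ν θ.A₁ p (gOfRecord₁₃ F N θ.toStage13Params p) (θ.zhAt p s) := rfl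

/-- The residual serving the history reads the level and the WHOLE set-sequences (`rfl`). [cite: Balaban1988Convergent, p.257, (2.20)–(2.22) p.258 (bookkeeping)] -/
theorem zhAt_eq {n : ℕ} (s : SeqOfRecord F θ.ν θ.τ9.M (gOfRecord₁₃ F N θ.toStage13Params p) p.K n) : θ.zhAt p s = θ.Zh p n s.Ω s.Λ := rfl

end Faces

/-! ## §3. ★ Level one of `TLaw₁₃CoPH` at the all-large-field new sequence under the generation-0 pin on `θ.zhAt p s′` -/

section LevelOne

variable (θ : Stage13HParams F N) (p : B12.RunParams)

/-- All `Ω_j` of a length-1 sequence with `Ω₁ = ∅` are empty (bookkeeping for §1). [cite: Balaban1988Convergent, (2.1) p.254 (bookkeeping)] -/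
theorem forall_Omega_empty_of_one {ν : Stage7Numerics} {M : ℕ} {g : ℕ → ℝ} {K : ℕ} (s : SeqOfRecord F ν M g K 1) (hΩ : s.Ω 1 = ∅) :
    ∀ j, 1 ≤ j → j ≤ 1 → s.Ω j = ∅ := fun j h1 h2 => by
  obtain rfl : j = 1 := le_antisymm h2 h1
  exact hΩ

/-- **★ THE FIRST (S1ᵀ) IDENTITY OF THE v1.7 RECORD, GENERIC `θ : Stage13HParams`.**  At the all-large-field new sequence `s′` (`Ω₁(s′) = ∅`), under the pin of the
HISTORY's residual at generation 0, `(θ.zhAt p s′).ζ0 0 T (U, V₁) = w(s′)(U, Ū)`, and `(θ.zhAt p s′).quad 0 ∅ (U, V₁) = 0`: for EVERY term-value witness `t`,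
`slotT_1(s′)(V₁) = 𝐓_1(s′)[WtOfRecord₁₃H θ p s′] e^{A_1(s′)[θ.rzAt p s′]}(V₁)` `dV₁`-a.e., with `E_1(s′) = E(p)` (unity of def-T's `ζ`, displayed joint measurability of
`w(s′)`, `0 < K`, `1 ≤ M`).  = p532335's free-`Z` theorem at `Z := θ.zhAt p s′` + §1 (the history's residual replaces the torus's). [cite: Balaban1988Convergent, Theorem p.245, (3.25) p.270, (1.11) p.248, (2.18) p.257, (2.21)–(2.25) pp.258–259] -/
theorem slotsT_one_ae_eq_sect2Slot_CoPH_of_zeta0_pin (hK : 0 < p.K) (hM : 1 ≤ θ.τ9.M) (hζu : IsZetaUnity F N θ.ν θ.τ9.M θ.ζ)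
    (s : SeqOfRecord F θ.ν θ.τ9.M (gOfRecord₁₃ F N θ.toStage13Params p) p.K 1) (hΩ : s.Ω 1 = ∅)
    (t : Sect2.TermValues (F.P p.K) (MatA N) (FluctV N) θ.τ9.M)
    (hZ : ∀ (V1 : GaugeField (F.P p.K) 1 (SU N)) (Uf : GaugeField (F.P p.K) 0 (SU N)),
      (θ.zhAt p s).ζ0 0 Set.univ (pairCfg (V := FluctV N) V1 Uf) =
        wOfRecord₉ F N θ.toStage9Params p (gOfRecord₁₃ F N θ.toStage13Params p) 0 s Uf ((avOfRecord F N p.K 0).avg Uf))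
    (hq : ∀ (V1 : GaugeField (F.P p.K) 1 (SU N)) (Uf : GaugeField (F.P p.K) 0 (SU N)), (θ.zhAt p s).quad 0 ∅ (pairCfg (V := FluctV N) V1 Uf) = 0)
    (hmw : Measurable fun z : GaugeField (F.P p.K) 1 (SU N) × GaugeField (F.P p.K) 0 (SU N) =>
      wOfRecord₉ F N θ.toStage9Params p (gOfRecord₁₃ F N θ.toStage13Params p) 0 s z.2 z.1) :
    ∀ᵐ V1 ∂fieldMeasure (F.P p.K) 1 (SU N),
      chiSeqOfRecord F N θ.ν θ.τ9.M (gOfRecord₁₃ F N θ.toStage13Params p) p.K 1 s V1 ≠ 0 →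
        slotsTOfRecord F N θ.ν θ.τ9 (EOfRecord₁₃ F N θ.toStage13Params) (wOfRecord₉ F N θ.toStage9Params) θ.ppSel p
            (gOfRecord₁₃ F N θ.toStage13Params p) 1 s V1 =
          sect2Slot F N (FluctV N) p.K (settingOfRecord₁₃ F N θ.toStage13Params p) (θ.rzAt p s) (WtOfRecord₁₃H F N θ p s) s t
            (EOfRecord₁₃ F N θ.toStage13Params p) (UbgOfRecord₁₃CoP F N θ.toStage13Params p 1 s) V1 := by
  have h := slotsT_one_ae_eq_sect2Slot_atZ_of_zeta0_pin θ.toStage13Params p (θ.zhAt p s) hK hM hζu s hΩ t hZ hq hmw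
  rw [WtOfRecord₁₃H_eq_tkWeightsOfRecordP,
    sect2Slot_congr_residual_of_forall_Omega_empty (settingOfRecord₁₃ F N θ.toStage13Params p) (θ.rzAt p s) (θ.Rz p.K) _ hM s
      (forall_Omega_empty_of_one s hΩ) t _ _]
  exact h

/-- **… HENCE THE DICHOTOMY CLAUSE OF `HasSect2FormAtZS` (the shape of `TLaw₁₃CoPH θ p 0`'s clause) AT `s′`**, identity branch, witness `(t, E(p))`.
[cite: Balaban1988Convergent, (2.17)–(2.18) p.257, (3.25) p.270, remark p.262] -/
theorem hasSect2FormAtZS_clause_one_CoPH_of_zeta0_pin (hK : 0 < p.K) (hM : 1 ≤ θ.τ9.M) (hζu : IsZetaUnity F N θ.ν θ.τ9.M θ.ζ)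
    (s : SeqOfRecord F θ.ν θ.τ9.M (gOfRecord₁₃ F N θ.toStage13Params p) p.K 1) (hΩ : s.Ω 1 = ∅)
    (t : Sect2.TermValues (F.P p.K) (MatA N) (FluctV N) θ.τ9.M)
    (hZ : ∀ (V1 : GaugeField (F.P p.K) 1 (SU N)) (Uf : GaugeField (F.P p.K) 0 (SU N)),
      (θ.zhAt p s).ζ0 0 Set.univ (pairCfg (V := FluctV N) V1 Uf) =
        wOfRecord₉ F N θ.toStage9Params p (gOfRecord₁₃ F N θ.toStage13Params p) 0 s Uf ((avOfRecord F N p.K 0).avg Uf))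
    (hq : ∀ (V1 : GaugeField (F.P p.K) 1 (SU N)) (Uf : GaugeField (F.P p.K) 0 (SU N)), (θ.zhAt p s).quad 0 ∅ (pairCfg (V := FluctV N) V1 Uf) = 0)
    (hmw : Measurable fun z : GaugeField (F.P p.K) 1 (SU N) × GaugeField (F.P p.K) 0 (SU N) =>
      wOfRecord₉ F N θ.toStage9Params p (gOfRecord₁₃ F N θ.toStage13Params p) 0 s z.2 z.1) :
    slotsTOfRecord F N θ.ν θ.τ9 (EOfRecord₁₃ F N θ.toStage13Params) (wOfRecord₉ F N θ.toStage9Params) θ.ppSel p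
        (gOfRecord₁₃ F N θ.toStage13Params p) 1 s = 0 ∨
      ∀ᵐ V1 ∂fieldMeasure (F.P p.K) 1 (SU N),
        chiSeqOfRecord F N θ.ν θ.τ9.M (gOfRecord₁₃ F N θ.toStage13Params p) p.K 1 s V1 ≠ 0 →
          slotsTOfRecord F N θ.ν θ.τ9 (EOfRecord₁₃ F N θ.toStage13Params) (wOfRecord₉ F N θ.toStage9Params) θ.ppSel p
              (gOfRecord₁₃ F N θ.toStage13Params p) 1 s V1 =
            sect2Slot F N (FluctV N) p.K (settingOfRecord₁₃ F N θ.toStage13Params p) (θ.rzAt p s) (WtOfRecord₁₃H F N θ p s) s t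
              (EOfRecord₁₃ F N θ.toStage13Params p) (UbgOfRecord₁₃CoP F N θ.toStage13Params p 1 s) V1 :=
  Or.inr (slotsT_one_ae_eq_sect2Slot_CoPH_of_zeta0_pin θ p hK hM hζu s hΩ t hZ hq hmw)

/-- **… keyed on def-T's v1.7 core provisos** (`zetaUnity`, `tstep … .measW`): only the two pin hypotheses on `θ.zhAt p s′` and `0 < K`, `1 ≤ M` remain displayed.
[cite: Balaban1988Convergent, (2.17)–(2.18) p.257, (3.25) p.270, (3.2)–(3.9) pp.265–266] -/
theorem hasSect2FormAtZS_clause_one_CoPH_of_provisos (h : θ.Provisos₁₃CoPH F N) (hK : 0 < p.K) (hM : 1 ≤ θ.τ9.M)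
    (s : SeqOfRecord F θ.ν θ.τ9.M (gOfRecord₁₃ F N θ.toStage13Params p) p.K 1) (hΩ : s.Ω 1 = ∅)
    (t : Sect2.TermValues (F.P p.K) (MatA N) (FluctV N) θ.τ9.M)
    (hZ : ∀ (V1 : GaugeField (F.P p.K) 1 (SU N)) (Uf : GaugeField (F.P p.K) 0 (SU N)),
      (θ.zhAt p s).ζ0 0 Set.univ (pairCfg (V := FluctV N) V1 Uf) =
        wOfRecord₉ F N θ.toStage9Params p (gOfRecord₁₃ F N θ.toStage13Params p) 0 s Uf ((avOfRecord F N p.K 0).avg Uf))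
    (hq : ∀ (V1 : GaugeField (F.P p.K) 1 (SU N)) (Uf : GaugeField (F.P p.K) 0 (SU N)), (θ.zhAt p s).quad 0 ∅ (pairCfg (V := FluctV N) V1 Uf) = 0) :
    slotsTOfRecord F N θ.ν θ.τ9 (EOfRecord₁₃ F N θ.toStage13Params) (wOfRecord₉ F N θ.toStage9Params) θ.ppSel p
        (gOfRecord₁₃ F N θ.toStage13Params p) 1 s = 0 ∨
      ∀ᵐ V1 ∂fieldMeasure (F.P p.K) 1 (SU N),
        chiSeqOfRecord F N θ.ν θ.τ9.M (gOfRecord₁₃ F N θ.toStage13Params p) p.K 1 s V1 ≠ 0 →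
          slotsTOfRecord F N θ.ν θ.τ9 (EOfRecord₁₃ F N θ.toStage13Params) (wOfRecord₉ F N θ.toStage9Params) θ.ppSel p
              (gOfRecord₁₃ F N θ.toStage13Params p) 1 s V1 =
            sect2Slot F N (FluctV N) p.K (settingOfRecord₁₃ F N θ.toStage13Params p) (θ.rzAt p s) (WtOfRecord₁₃H F N θ p s) s t
              (EOfRecord₁₃ F N θ.toStage13Params p) (UbgOfRecord₁₃CoP F N θ.toStage13Params p 1 s) V1 :=
  hasSect2FormAtZS_clause_one_CoPH_of_zeta0_pin θ p hK hM h.zetaUnity s hΩ t hZ hq ((h.tstep p 0 hK).measW s)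

end LevelOne

end Summit.QuantumFields.YangMills.Theorems.BalabanUVNodesN11NoExpansionDiagonalCoPH

end
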